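import Summits.FinalStateConjecture.FinalStateConjecture.Theorems.PhaseMixingCaptureCaptureSufficesTameNoC0MainLemma
import Summits.FinalStateConjecture.FinalStateConjecture.Theorems.PhaseMixingCaptureCaptureSufficesTameNoC0Reduction
import HarnessLib

/-!
# NoC0KerrChart: no `C⁰`-honest late chart of a boosted Kerr exterior into Minkowski space

Crux `CaptureSufficesTame` (stmt-FinalStateConjecture-17270), line `only-the-third-law-is-generic`, G's model point
(`stub_labelRigidityC0` at the Minkowski development), lead c10: the registered sub-goal `stub_noC0KerrChartIntoMinkowski`
— for `0 < M`, `|a| ≤ M`, no late-chart comparison map `Ψ` from a boosted Kerr background into the Minkowski spacetime has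
all its `C⁰` truncated deviations tending to `0` — is the reduction `stub_noC0_reduction` (boost/reflection/time-shift/chart
calculus, p167023) applied to the Main Lemma `stub_noC0_mainLemma` (limit argument along the retrograde photon orbit:
flat light cones have no conjugate points and their generators would shadow the closed photon orbit for a full period,
forcing the static observer at `p₀` into the future null cone of `p₀`). With `stub_labelRigidityC0_minkowski_of_noC0KerrChart`
(p146217) this settles G's model point. References: J. Sbierski, J. Diff. Geom. 108 (2018) / arXiv:1507.00601 (key `Sbierski2016AHP`);
Anal. PDE 8 (2015) §7A (key `Sbierski2015`).
-/

set_option linter.dupNamespace false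

noncomputable section

open Set Filter Function Bundle Metric
open scoped Manifold ContDiff Topology ENNReal

namespace Summit.FinalStateConjecture.FinalStateConjecture.Theorems.PhaseMixingCaptureCaptureSufficesTame

open Literature.Geometry.Lorentzian

/-- **Registered sub-goal `stub_noC0KerrChartIntoMinkowski`** (G's model point, NoC0KerrChart): no late chart of a boosted Kerr
exterior (`0 < M`, `|a| ≤ M`) into Minkowski space is `C⁰`-honest (all truncated `C⁰` deviations `→ 0`). Proof:
`stub_noC0_reduction` applied to `stub_noC0_mainLemma`. [cite: Sbierski2016AHP, §3.2, Thm. 12] -/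
theorem stub_noC0KerrChartIntoMinkowski :
    ∀ (Λ : lorentzGroup) (c : E4) (M a τ₀ : ℝ), 0 < M → |a| ≤ M → ∀ Ψ : (boostedKerrBackground Λ c M a).domain → Minkowski.spacetime.carrier, Minkowski.spacetime.IsLateChart (boostedKerrBackground Λ c M a) univ τ₀ Ψ → ¬ ∀ R : ℝ, Tendsto (fun τ ↦ Minkowski.spacetime.truncDeviationCk (boostedKerrBackground Λ c M a) Ψ 0 R τ) atTop (𝓝 0) :=
  stub_noC0_reduction stub_noC0_mainLemma

end Summit.FinalStateConjecture.FinalStateConjecture.Theorems.PhaseMixingCaptureCaptureSufficesTame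

end
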